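import Summits.AtomisticToContinuum.Crystallization.Theses.SpectralChargeLedger
import Literature.MathematicalPhysics.StatisticalMechanics.LocalMatchingCompactness

/-!
# Sketch — crux `ShellsToLayers` (stmt-AtomisticToContinuum-17254), ideator 1, round 1

First lemmas of the two idea cards (signatures only; `sorry` bodies):

* card A `kuratowski-limit-onto-landed-layering`: `stubA_exactShellsLayered` (the τ = 0, R' = ∞ core in
  the crux's own window format) and the transfer `ShellsToLayers_of_exactWindows` (local-rubber
  compactness, contrapositive);
* card B `germ-section-development`: `stubB_germSection` (laminar labels from τ-good shells on a ball,
  effective) and `stubB_sheetDevelopment` (labels ⇒ window, effective; twin of LaminarRigidity 14295).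
-/

noncomputable section

namespace Summit.AtomisticToContinuum.Crystallization.Cruxes.ShellsToLayers.Ideator1

open Literature.MathematicalPhysics.StatisticalMechanics

local notation "E3" => EuclideanSpace ℝ (Fin 3)

/-- The model punctured `13/10·a₀`-shell of the hcp stacking at the origin (anticuboctahedron). -/
def modelShellH (a₀ h₀ : ℝ) : Set E3 :=
  {p : E3 | p ∈ hcpStacking a₀ h₀ ∧ p ≠ 0 ∧ ‖p‖ < 13 / 10 * a₀}

/-- The model punctured `13/10·a₀`-shell of the fcc stacking at the origin (cuboctahedron). -/
def modelShellF (a₀ h₀ : ℝ) : Set E3 :=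
  {p : E3 | p ∈ fccStacking a₀ h₀ ∧ p ≠ 0 ∧ ‖p‖ < 13 / 10 * a₀}

/-- The punctured open `13/10·a₀`-shell of `y` in a point SET `Y`. -/
def shell (a₀ : ℝ) (Y : Set E3) (y : E3) : Set E3 :=
  {z : E3 | z ∈ Y ∧ z ≠ y ∧ dist z y < 13 / 10 * a₀}

/-- `τ`-congruence of the shell of `y` in `Y` to a pattern `P` (bijection + linear isometry). -/
def GoodFor (P : Set E3) (a₀ τ : ℝ) (Y : Set E3) (y : E3) : Prop :=
  ∃ A : E3 →ₗᵢ[ℝ] E3, ∃ e : ↥(shell a₀ Y y) ≃ ↥P,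
    ∀ t : ↥(shell a₀ Y y), dist ((t : E3) - y) (A ((e t : ↥P) : E3)) ≤ τ

/-- `τ`-goodness (either letter) — the crux's hypothesis predicate, for sets. -/
def Good (a₀ h₀ τ : ℝ) (Y : Set E3) (y : E3) : Prop :=
  GoodFor (modelShellH a₀ h₀) a₀ τ Y y ∨ GoodFor (modelShellF a₀ h₀) a₀ τ Y y

/-- The layered set of the window format (`= A '' barlowStackingH a₀ z s`). -/
def layeredSet (a₀ : ℝ) (A : E3 →ₗᵢ[ℝ] E3) (s : ℤ → ℤ) (z : ℤ → ℝ) : Set E3 :=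
  {p : E3 | ∃ m i j : ℤ, p = A (((i : ℝ) • triangularVec₁ a₀) + ((j : ℝ) • triangularVec₂ a₀) +
    ((haggLabel s m : ℝ) • barlowOffset a₀) + (z m • layerNormal 1))}

/-- The crux's `(R, ε)`-window, for a point set `Y`. -/
def HasWindow (a₀ R ε : ℝ) (Y : Set E3) : Prop :=
  ∃ (A : E3 →ₗᵢ[ℝ] E3) (t : E3) (s : ℤ → ℤ) (z : ℤ → ℝ), IsHaggSeq s ∧
    (∀ m : ℤ, 39 / 50 * a₀ ≤ z (m + 1) - z m ∧ z (m + 1) - z m ≤ 17 / 20 * a₀) ∧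
    (∀ p ∈ layeredSet a₀ A s z, ‖p‖ ≤ R → ∃ y ∈ Y, dist (y + t) p ≤ ε) ∧
    (∀ y ∈ Y, ‖y + t‖ ≤ R → ∃ p ∈ layeredSet a₀ A s z, dist (y + t) p ≤ ε)

/-! ## Card A — `kuratowski-limit-onto-landed-layering` -/

/-- **First lemma of card A (the `τ = 0`, `R' = ∞` core in the crux's window format).**  A point set
containing `0` all of whose sites are, for EVERY `η > 0`, `η`-good at scale `(a₀, h₀)` (either letter,
site by site) is a translate of a rigid image of an exactly layered Barlow-type set with in-layer
spacing EXACTLY `a₀`, some Hägg word and ALL interlayer increments EXACTLY `h₀`.  Intended proof: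
exactify each shell (`ExactHcpLocal.exists_equiv_forall_eta` + Gram ⇒ isometry, both letters), feed
`CleanHull.stub_layeredOfExactShells` at `a = a₀` with slots `slotH/slotC a₀ h₀ h₀`, read `a' = a₀`,
`Δz = h₀` off one exact shell. -/
theorem stubA_exactShellsLayered (a₀ h₀ : ℝ) (ha : 47 / 50 ≤ a₀) (ha' : a₀ ≤ 1)
    (hh : |h₀ - a₀ * Real.sqrt (2 / 3)| ≤ a₀ / 100) (Y : Set E3) (h0 : (0 : E3) ∈ Y)
    (hexact : ∀ y ∈ Y, ∀ η : ℝ, 0 < η → Good a₀ h₀ η Y y) :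
    ∃ (A : E3 →ₗᵢ[ℝ] E3) (s : ℤ → ℤ) (z : ℤ → ℝ) (v : E3), IsHaggSeq s ∧
      (∀ m : ℤ, z (m + 1) - z m = h₀) ∧ Y = (fun p => p + v) '' layeredSet a₀ A s z := by
  sorry

/-- Consequence used by the transfer: everywhere-exact sets have windows at every scale. -/
theorem hasWindow_of_exact (a₀ h₀ : ℝ) (ha : 47 / 50 ≤ a₀) (ha' : a₀ ≤ 1)
    (hh : |h₀ - a₀ * Real.sqrt (2 / 3)| ≤ a₀ / 100) (Y : Set E3) (h0 : (0 : E3) ∈ Y)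
    (hexact : ∀ y ∈ Y, ∀ η : ℝ, 0 < η → Good a₀ h₀ η Y y) (R ε : ℝ) (hε : 0 < ε) :
    HasWindow a₀ R ε Y := by
  sorry

/-- **Transfer (card A): local-rubber compactness, contrapositive.**  If everywhere-exact sets have
windows at every scale, the crux holds: a failing family `(τₙ → 0, R'ₙ → ∞, yⁿ, iₙ)` recentred at
`yⁿ iₙ` has a `δ`-separated local limit `Y ∋ 0` (`exists_subseq_forall_eventually_ballMatch`),
goodness passes to the limit for every `η` (`good_of_limit`, pattern-generic), windows are open
conditions in the local matching topology — contradiction. -/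
theorem ShellsToLayers_of_exactWindows
    (hA : ∀ a₀ h₀ : ℝ, 47 / 50 ≤ a₀ → a₀ ≤ 1 → |h₀ - a₀ * Real.sqrt (2 / 3)| ≤ a₀ / 100 →
      ∀ Y : Set E3, (0 : E3) ∈ Y → (∀ y ∈ Y, ∀ η : ℝ, 0 < η → Good a₀ h₀ η Y y) →
      ∀ R ε : ℝ, 0 < ε → HasWindow a₀ R ε Y) :
    Summit.AtomisticToContinuum.Crystallization.Theses.SpectralChargeLedger.ShellsToLayers := by
  sorry

/-! ## Card B — `germ-section-development` (effective, no limit objects) -/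

/-- **First lemma of card B (germ section ⇒ laminar labels, effective).**  For `(a₀, h₀)` in the box
there are `τ₀ > 0` and `C` such that, for `τ ≤ τ₀`, if every site within `L + C·a₀` of `y i` is
`τ`-good (radius `2L + C·a₀`) then the sites within `L` of `y i` carry integer layer labels `l` and a unit normal `n`
with: every short pair (`dist < 13/10·a₀`) is in-layer (`Δl = 0`, nearly horizontal, length
`a₀ ± τ`) or interlayer (`Δl = ±1`, height `±h₀` up to the drift `C·τ·(1 + L/a₀)`).  The germ at an
hcp-type site is its unique hexagon plane, at an fcc-type site one of four; propagation rules = the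
exact bond-star continuation census (folder `num/bondstar*.out`), consistent on the ball because
h-sheets are complete inside the good ball and two non-parallel ones meeting `B(y i, L)` would meet
inside `B(y i, 1.74 L + 2 a₀)`, where the hard core (off-row sites of one sheet come within `0.79 a₀` of
the other) or germ uniqueness on a pointwise shared row excludes their coexistence. -/
theorem stubB_germSection (a₀ h₀ : ℝ) (ha : 47 / 50 ≤ a₀) (ha' : a₀ ≤ 1)
    (hh : |h₀ - a₀ * Real.sqrt (2 / 3)| ≤ a₀ / 100) :
    ∃ τ₀ C : ℝ, 0 < τ₀ ∧ 0 < C ∧ ∀ τ : ℝ, 0 < τ → τ ≤ τ₀ → ∀ L : ℝ, 0 < L →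
      ∀ (N : ℕ) (y : Fin N → E3) (i : Fin N),
        (∀ j : Fin N, dist (y j) (y i) ≤ 2 * L + C * a₀ → Good a₀ h₀ τ (Set.range y) (y j)) →
        ∃ n : E3, ‖n‖ = 1 ∧ ∃ l : Fin N → ℤ, l i = 0 ∧
          ∀ j k : Fin N, dist (y j) (y i) ≤ L → k ≠ j → dist (y k) (y j) < 13 / 10 * a₀ →
            (l k = l j ∧ |inner ℝ (y k - y j) n| ≤ C * τ * (1 + L / a₀) ∧ |dist (y k) (y j) - a₀| ≤ τ) ∨
            (l k = l j + 1 ∧ |inner ℝ (y k - y j) n - h₀| ≤ C * τ * (1 + L / a₀)) ∨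
            (l k = l j - 1 ∧ |inner ℝ (y k - y j) n + h₀| ≤ C * τ * (1 + L / a₀)) := by
  sorry

/-- **Second lemma of card B (sheet development, effective; twin of `LaminarRigidity` 14295 in the
crux's format).**  Laminar labels as above on the `(2R + 4a₀)`-ball, with the explicit tolerance
`τ ≤ c · ε · (a₀ / R)²`, give the `(R, ε)`-window at `y i` (2-D development of each labelled sheet
into an exact triangular lattice of spacing `a₀`, registry of consecutive sheets ⇒ Hägg word,
heights `z` = mean sheet heights, increments `h₀ ± O(τ)` ⊂ `[39a₀/50, 17a₀/20]`). -/
theorem stubB_sheetDevelopment (a₀ h₀ : ℝ) (ha : 47 / 50 ≤ a₀) (ha' : a₀ ≤ 1)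
    (hh : |h₀ - a₀ * Real.sqrt (2 / 3)| ≤ a₀ / 100) (C : ℝ) (hC : 0 < C) :
    ∃ c : ℝ, 0 < c ∧ ∀ R ε τ : ℝ, 1 ≤ R → 0 < ε → 0 < τ → τ ≤ c * ε * (a₀ / R) ^ 2 →
      ∀ (N : ℕ) (y : Fin N → E3) (i : Fin N),
        (∀ j k : Fin N, j ≠ k → dist (y k) (y j) < 13 / 10 * a₀ → 99 / 100 * a₀ - τ ≤ dist (y k) (y j)) →
        (∀ j : Fin N, dist (y j) (y i) ≤ 2 * R + 4 * a₀ → Good a₀ h₀ τ (Set.range y) (y j)) →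
        (∃ n : E3, ‖n‖ = 1 ∧ ∃ l : Fin N → ℤ, l i = 0 ∧
          ∀ j k : Fin N, dist (y j) (y i) ≤ 2 * R + 4 * a₀ → k ≠ j → dist (y k) (y j) < 13 / 10 * a₀ →
            (l k = l j ∧ |inner ℝ (y k - y j) n| ≤ C * τ * (1 + 4 * R / a₀) ∧ |dist (y k) (y j) - a₀| ≤ τ) ∨
            (l k = l j + 1 ∧ |inner ℝ (y k - y j) n - h₀| ≤ C * τ * (1 + 4 * R / a₀)) ∨
            (l k = l j - 1 ∧ |inner ℝ (y k - y j) n + h₀| ≤ C * τ * (1 + 4 * R / a₀))) →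
        HasWindow a₀ R ε (Set.range y) := by
  sorry

/-! ## Sanity: the set predicates are the crux's, definitionally -/

example (a₀ h₀ τ : ℝ) (N : ℕ) (y : Fin N → E3) (j : Fin N) :
    Good a₀ h₀ τ (Set.range y) (y j) ↔
      ((∃ A : E3 →ₗᵢ[ℝ] E3, (∃ e : ↥{z : E3 | z ∈ Set.range y ∧ z ≠ y j ∧ dist z (y j) < 13 / 10 * a₀} ≃
          ↥{p : E3 | p ∈ hcpStacking a₀ h₀ ∧ p ≠ 0 ∧ ‖p‖ < 13 / 10 * a₀},
          ∀ t : ↥{z : E3 | z ∈ Set.range y ∧ z ≠ y j ∧ dist z (y j) < 13 / 10 * a₀},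
            dist ((t : E3) - y j) (A ((e t : ↥{p : E3 | p ∈ hcpStacking a₀ h₀ ∧ p ≠ 0 ∧ ‖p‖ < 13 / 10 * a₀}) : E3)) ≤ τ)) ∨
       (∃ A : E3 →ₗᵢ[ℝ] E3, (∃ e : ↥{z : E3 | z ∈ Set.range y ∧ z ≠ y j ∧ dist z (y j) < 13 / 10 * a₀} ≃
          ↥{p : E3 | p ∈ fccStacking a₀ h₀ ∧ p ≠ 0 ∧ ‖p‖ < 13 / 10 * a₀},
          ∀ t : ↥{z : E3 | z ∈ Set.range y ∧ z ≠ y j ∧ dist z (y j) < 13 / 10 * a₀},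
            dist ((t : E3) - y j) (A ((e t : ↥{p : E3 | p ∈ fccStacking a₀ h₀ ∧ p ≠ 0 ∧ ‖p‖ < 13 / 10 * a₀}) : E3)) ≤ τ))) :=
  Iff.rfl

end Summit.AtomisticToContinuum.Crystallization.Cruxes.ShellsToLayers.Ideator1
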